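import Mathlib
import Summits.Ventures.PercRepro2.Defs
import Summits.Ventures.PercRepro2.Graph
import Summits.Ventures.PercRepro2.OneColourSwitch
import Summits.Ventures.PercRepro2.RegionHubSign
import Summits.Ventures.PercRepro2.SideSwitch
import Summits.Ventures.PercRepro2.TermSwitchDefs
import Summits.Ventures.PercRepro2.M9NoPocketDefs
import Summits.Ventures.PercRepro2.M9PsiOneDefs
import Summits.Ventures.PercRepro2.M9PsiOneWorlds

/-!
# The `W`-world of `Ψ₁ ω` and the legality of `Ψ₁ ω` (blind cell PercRepro2, p3 g31,
2026-08-28; `proofs/P3-PAYMENT.md` §2, claim (i))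

The `W`-world of `Ψ₁ ω` lies in `{r, s} ∪ Fnl` (`M2_psiOne_subset`: the set is closed under
the closed edges of `Ψ₁ ω`), so with `K₂(Ψ₁ ω) ⊆ Z` (`M9PsiOneWorlds`): `Ψ₁ ω` is `Sep`
(`sep2_psiOne`), `DZero` (`DZero_psiOne`, hence `DOne_psiOne`) and `d ∉ M₂(Ψ₁ ω)`
(`not_mem_M2_psiOne`).  Own work; std axioms.
-/

namespace Summit.Ventures.PercRepro2

namespace NoPocket

open Finset Classical RegionHub OneColourSwitch SideSwitch TermSwitch

variable {V : Type*} {E : Type*}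

section WorldsM

variable {ends : E → Sym2 V} {p q r s d : V} {ω : Config E}

variable (h : IsEX ends p q r s d ω)
include h

/-- **`{r, s} ∪ Fnl` is closed under the closed edges of `Ψ₁ ω`.** -/
lemma Tset_closed :
    ∀ x ∈ ({r, s} : Set V) ∪ Fnl ends r s d ω, ∀ y,
      (openGraph ends (OneColourSwitch.compl (psiOne ends r s d ω))).Adj x y →
        y ∈ ({r, s} : Set V) ∪ Fnl ends r s d ω := by
  intro x hx y hxy
  obtain ⟨hne, e, he, hends⟩ := openGraph_adj.1 hxy
  have he' : psiOne ends r s d ω e = false := by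
    simpa [OneColourSwitch.compl] using he
  rcases vertex_cases (ends := ends) (r := r) (s := s) (d := d) (ω := ω) y with
    hy | hy | hy | hyK | hyM | hyO
  · exact hy ▸ term_mem_Tset (Or.inl rfl)
  · exact hy ▸ term_mem_Tset (Or.inr rfl)
  · exfalso
    rcases hx with hxT | hxF
    · simp only [Set.mem_insert_iff, Set.mem_singleton_iff] at hxT
      rcases hxT with hx | hx
      · exact no_edge_d_term h (Or.inl hx) (ends_swap (hy ▸ hends))
      · exact no_edge_d_term h (Or.inr hx) (ends_swap (hy ▸ hends))
    · exact hxF.2.1 (mem_joinedY_of_adj_d hxF.1 (hy ▸ hends))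
  · rcases hx with hxT | hxF
    · simp only [Set.mem_insert_iff, Set.mem_singleton_iff] at hxT
      rcases Kcore_cases hyK with hyJ | hyF
      · exfalso
        rcases hxT with hx | hx
        · rw [psiOne_term_Kcore h (Or.inl hx) hyK hends, if_pos hyJ] at he'
          exact Bool.noConfusion he'
        · rw [psiOne_term_Kcore h (Or.inr hx) hyK hends, if_pos hyJ] at he'
          exact Bool.noConfusion he'
      · exact Or.inr hyF
    · refine Or.inr ⟨hyK, ?_, ?_⟩
      · intro hyJ; exact hxF.2.1 (mem_joinedY_of_edge hyJ hxF.1 (ends_swap hends))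
      · intro hyL; exact hxF.2.2 (mem_linkSetY_of_edge hyL hxF.1 (ends_swap hends))
  · exfalso
    rcases hx with hxT | hxF
    · simp only [Set.mem_insert_iff, Set.mem_singleton_iff] at hxT
      rcases hxT with hx | hx
      · rw [psiOne_term_Mcore h (Or.inl hx) hyM hends] at he'; exact Bool.noConfusion he'
      · rw [psiOne_term_Mcore h (Or.inr hx) hyM hends] at he'; exact Bool.noConfusion he'
    · exact no_edge_core_core h hxF.1 hyM hends
  · exfalso
    rcases hx with hxT | hxF
    · simp only [Set.mem_insert_iff, Set.mem_singleton_iff] at hxT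
      rcases hxT with hx | hx
      · exact no_edge_out_term h hyO (Or.inl hx) hends
      · exact no_edge_out_term h hyO (Or.inr hx) hends
    · rw [psiOne_Fnl_out h hxF hyO hends] at he'; exact Bool.noConfusion he'

/-- **`M₂(Ψ₁ ω) ⊆ {r, s} ∪ Fnl`.** -/
theorem M2_psiOne_subset :
    M2 ends r s (psiOne ends r s d ω) ⊆ ({r, s} : Set V) ∪ Fnl ends r s d ω := by
  intro x hx
  rcases mem_M2_iff.1 hx with hc | hc
  · exact mem_of_conn_of_closed (Tset_closed h) (term_mem_Tset (Or.inl rfl)) hc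
  · exact mem_of_conn_of_closed (Tset_closed h) (term_mem_Tset (Or.inr rfl)) hc

/-- `d` is not in the `W`-world of `Ψ₁ ω`. -/
theorem not_mem_M2_psiOne : d ∉ M2 ends r s (psiOne ends r s d ω) := by
  intro hd
  rcases M2_psiOne_subset h hd with hT | hF
  · simp only [Set.mem_insert_iff, Set.mem_singleton_iff] at hT
    rcases hT with hT | hT
    · exact h.hr hT
    · exact h.hs hT
  · exact d_not_mem_Kcore hF.1

/-- A vertex outside both worlds of `ω` is outside `Z`. -/
lemma not_mem_Zset_of_out {x : V} (hxK : x ∉ K2 ends r s ω) (hxM : x ∉ M2 ends r s ω) :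
    x ∉ Zset ends r s d ω := by
  rintro (((hT | hJ) | hL) | hM)
  · simp only [Set.mem_insert_iff, Set.mem_singleton_iff] at hT
    rcases hT with rfl | rfl | rfl
    · exact hxK (r_mem_K2 ω)
    · exact hxK (s_mem_K2 ω)
    · exact hxK h.inK
  · exact hxK (joinedY_subset_Kcore hJ).1
  · exact hxK hL.1.1
  · exact hxM hM.1

/-- A vertex outside the `Y`-world of `ω` is outside `{r, s} ∪ Fnl`. -/
lemma not_mem_Tset_of_out {x : V} (hxK : x ∉ K2 ends r s ω) :
    x ∉ ({r, s} : Set V) ∪ Fnl ends r s d ω := by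
  rintro (hT | hF)
  · simp only [Set.mem_insert_iff, Set.mem_singleton_iff] at hT
    rcases hT with rfl | rfl
    · exact hxK (r_mem_K2 ω)
    · exact hxK (s_mem_K2 ω)
  · exact hxK hF.1.1

/-- **`Ψ₁ ω` is `Sep`.** -/
theorem sep2_psiOne : sep2 ends p q r s (psiOne ends r s d ω) := by
  obtain ⟨⟨hpr, hps, hqr, hqs⟩, ⟨hpr', hps', hqr', hqs'⟩⟩ := h.sep
  have hpK : p ∉ K2 ends r s ω := fun hp => by
    rcases mem_K2_iff.1 hp with hc | hc
    · exact hpr (conn_symm hc)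
    · exact hps (conn_symm hc)
  have hqK : q ∉ K2 ends r s ω := fun hq => by
    rcases mem_K2_iff.1 hq with hc | hc
    · exact hqr (conn_symm hc)
    · exact hqs (conn_symm hc)
  have hpM : p ∉ M2 ends r s ω := fun hp => by
    rcases mem_M2_iff.1 hp with hc | hc
    · exact hpr' (conn_symm hc)
    · exact hps' (conn_symm hc)
  have hqM : q ∉ M2 ends r s ω := fun hq => by
    rcases mem_M2_iff.1 hq with hc | hc
    · exact hqr' (conn_symm hc)
    · exact hqs' (conn_symm hc)
  have hpK' : p ∉ K2 ends r s (psiOne ends r s d ω) :=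
    fun hp => not_mem_Zset_of_out h hpK hpM (K2_psiOne_subset h hp)
  have hqK' : q ∉ K2 ends r s (psiOne ends r s d ω) :=
    fun hq => not_mem_Zset_of_out h hqK hqM (K2_psiOne_subset h hq)
  have hpM' : p ∉ M2 ends r s (psiOne ends r s d ω) :=
    fun hp => not_mem_Tset_of_out h hpK (M2_psiOne_subset h hp)
  have hqM' : q ∉ M2 ends r s (psiOne ends r s d ω) :=
    fun hq => not_mem_Tset_of_out h hqK (M2_psiOne_subset h hq)
  refine ⟨⟨?_, ?_, ?_, ?_⟩, ⟨?_, ?_, ?_, ?_⟩⟩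
  · exact fun hc => hpK' (mem_K2_iff.2 (Or.inl (conn_symm hc)))
  · exact fun hc => hpK' (mem_K2_iff.2 (Or.inr (conn_symm hc)))
  · exact fun hc => hqK' (mem_K2_iff.2 (Or.inl (conn_symm hc)))
  · exact fun hc => hqK' (mem_K2_iff.2 (Or.inr (conn_symm hc)))
  · exact fun hc => hpM' (mem_M2_iff.2 (Or.inl (conn_symm hc)))
  · exact fun hc => hpM' (mem_M2_iff.2 (Or.inr (conn_symm hc)))
  · exact fun hc => hqM' (mem_M2_iff.2 (Or.inl (conn_symm hc)))
  · exact fun hc => hqM' (mem_M2_iff.2 (Or.inr (conn_symm hc)))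

/-- **`Ψ₁ ω` is `DZero`** (no vertex other than `r, s` in both worlds). -/
theorem DZero_psiOne : DZero ends r s (psiOne ends r s d ω) := by
  intro x hxr hxs hxK hxM
  rcases M2_psiOne_subset h hxM with hT | hF
  · simp only [Set.mem_insert_iff, Set.mem_singleton_iff] at hT
    rcases hT with rfl | rfl
    · exact hxr rfl
    · exact hxs rfl
  · rcases K2_psiOne_subset h hxK with ((hT | hJ) | hL) | hM
    · simp only [Set.mem_insert_iff, Set.mem_singleton_iff] at hT
      rcases hT with rfl | rfl | rfl
      · exact hxr rfl
      · exact hxs rfl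
      · exact d_not_mem_Kcore hF.1
    · exact hF.2.1 hJ
    · exact hF.2.2 hL
    · exact not_mem_Mcore_of_mem_Kcore h.done hF.1 hM

/-- **`Ψ₁ ω` is `DOne(d)`.** -/
theorem DOne_psiOne : DOne ends r s d (psiOne ends r s d ω) :=
  fun x hxr hxs _ hxK => DZero_psiOne h x hxr hxs hxK

end WorldsM

end NoPocket

end Summit.Ventures.PercRepro2
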